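/-
Copyright: rh-split cell (screw, width prover seat l1-w3) gen 0, 2026-08-27.  Splitting search over
kernel-typed RH-equivalences.  A splitting `A ∧ B ⟹ RH` is CONDITIONAL bookkeeping unless `A` and `B` are
both proved; nothing here bears on the truth of RH.
-/
import Summits.RiemannHypothesis.RiemannHypothesis.Theorems.Splittings.ScrewDustNonSeparation
import Summits.RiemannHypothesis.RiemannHypothesis.Theorems.Splittings.ScrewLatticeThinWall
import HarnessLib

/-!
# Dust walls: zero length ⟹ totally disconnected, and the place of TD(h) in the survivor chain

Route-independent support (no route file is imported) for the RH-equivalence X-11 «DUST WALL»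
(`CEIL(1) ∧ TD(1) ⟺ RH`), where `TD(h)` says that the closure `T_h` of the aliased pole field
`aliasedPoleSet h = {e^{∓(ρ-1/2)h}} ∩ 𝔻` meets the open unit disc in a TOTALLY DISCONNECTED set.
Everything here is RH-free and ζ-free except §3–§4, which only use the tree's dictionary.

1. Metric topology: a set of ZERO LENGTH (`μH[1] s = 0`) is totally disconnected
   (`isTotallyDisconnected_of_hausdorffMeasure_zero`; a preconnected set through `x ≠ y` is mapped by
   the `1`-Lipschitz function `dist x` onto a set containing the interval `[0, dist x y]`); corollaries
   for countable sets and sets of Hausdorff dimension `< 1`.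
2. Plane topology of a totally disconnected trace `T ∩ U` (`U` open): it contains no disc, so
   `U ⊆ closure (U ∖ T)` (`subset_closure_diff_of_isTotallyDisconnected`), and each of its points is a
   point-component (`connectedComponentIn_subset_singleton`).
3. The survivor chain X-9 ⊆ X-10 ⊆ X-11 conjunct-wise, every step `h`:
   `CC(h) ⟹ TW(h) ⟹ TD(h)`, `dimH < 1 ⟹ TD(h)`, `ES ⟹ TD(h)`, `FOZ ⟹ TD(h)`, `RH ⟹ TD(h)`.
4. RH-free and kernel-free consequence of the non-separation theorem of item 21692
   (`ScrewDust.isPreconnected_ball_diff_of_isTotallyDisconnected`) combined with the §19 WALLS theorem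
   (`exists_near_of_preconnected_of_latticeCeiling`): under `CEIL(h)` a dust wall has NO ISOLATED POLE —
   every aliased pole is an accumulation point of the wall (`exists_near_of_latticeCeiling_of_isTotallyDisconnected`).

RH is not proved by this; X-11 is a CONDITIONAL splitting whose conjunct TD(1) and residual CEIL(1) are
open.  Nothing here bears on the truth of RH.  No `sorry`, no new axioms, no definitions, no instances,
no notation.
-/

set_option linter.dupNamespace false

namespace Summit.RiemannHypothesis.RiemannHypothesis.Theorems.Splittings.ScrewDust

open Set Metric MeasureTheory
open scoped ENNReal
open Literature.NumberTheory.LFunctions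
open Summit.RiemannHypothesis.RiemannHypothesis.Theorems.Splittings.ScrewBorel
open Summit.RiemannHypothesis.RiemannHypothesis.Theorems.Splittings.ScrewBorelFlux
open Summit.RiemannHypothesis.RiemannHypothesis.Theorems.Splittings.ScrewLatticeContinuation
open Summit.RiemannHypothesis.RiemannHypothesis.Theorems.Splittings.ScrewLatticeThinWall

/-! ## 1. Zero length ⟹ totally disconnected -/

/-- **A set of zero length is totally disconnected.**  In a metric space, if `μH[1] s = 0` then every
preconnected subset of `s` is a subsingleton: a preconnected `t ∋ x, y` with `x ≠ y` is mapped by the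
`1`-Lipschitz function `dist x` onto a preconnected subset of `ℝ` containing `0` and `dist x y`, hence
containing `[0, dist x y]`, a set of length `dist x y > 0` — while Lipschitz maps do not increase length. -/
theorem isTotallyDisconnected_of_hausdorffMeasure_zero {X : Type*} [MetricSpace X]
    [MeasurableSpace X] [BorelSpace X] {s : Set X} (hs : μH[1] s = 0) :
    IsTotallyDisconnected s := by
  intro t hts ht
  by_contra hnt
  obtain ⟨x, hx, y, hy, hxy⟩ := Set.not_subsingleton_iff.1 hnt
  have hd : 0 < dist x y := dist_pos.2 hxy
  have himg : IsPreconnected (dist x '' t) :=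
    ht.image _ (continuous_const.dist continuous_id).continuousOn
  have hIcc : Icc 0 (dist x y) ⊆ dist x '' t :=
    himg.Icc_subset ⟨x, hx, dist_self x⟩ ⟨y, hy, rfl⟩
  have h1 : μH[1] (Icc (0 : ℝ) (dist x y)) = ENNReal.ofReal (dist x y) := by
    rw [hausdorffMeasure_real, Real.volume_Icc, sub_zero]
  have h2 : μH[1] (dist x '' t) ≤ μH[1] t := by
    simpa using (LipschitzWith.dist_right x).hausdorffMeasure_image_le zero_le_one t
  have h3 : μH[1] t = 0 := measure_mono_null hts hs
  have h4 : ENNReal.ofReal (dist x y) ≤ 0 :=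
    calc ENNReal.ofReal (dist x y) = μH[1] (Icc (0 : ℝ) (dist x y)) := h1.symm
      _ ≤ μH[1] (dist x '' t) := measure_mono hIcc
      _ ≤ μH[1] t := h2
      _ = 0 := h3
  have h5 : ENNReal.ofReal (dist x y) = 0 := le_antisymm h4 bot_le
  rw [ENNReal.ofReal_eq_zero] at h5
  linarith

/-- **Countable sets are totally disconnected** (metric spaces; countable sets have zero length). -/
theorem isTotallyDisconnected_of_countable {X : Type*} [MetricSpace X]
    [MeasurableSpace X] [BorelSpace X] {s : Set X} (hs : s.Countable) :
    IsTotallyDisconnected s := by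
  haveI := MeasureTheory.Measure.nullSingletonClass_hausdorff X one_pos
  exact isTotallyDisconnected_of_hausdorffMeasure_zero (hs.measure_zero _)

/-- **Sets of Hausdorff dimension `< 1` are totally disconnected** (metric spaces). -/
theorem isTotallyDisconnected_of_dimH_lt_one {X : Type*} [MetricSpace X]
    [MeasurableSpace X] [BorelSpace X] {s : Set X} (hs : dimH s < 1) :
    IsTotallyDisconnected s := by
  have h := hausdorffMeasure_of_dimH_lt (d := 1) (s := s) (by exact_mod_cast hs)
  exact isTotallyDisconnected_of_hausdorffMeasure_zero (by exact_mod_cast h)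

/-! ## 2. A totally disconnected trace contains no disc and has point-components only -/

/-- **A totally disconnected trace contains no disc**: if `U ⊆ ℂ` is open and `T ∩ U` is totally
disconnected, then every point of `U` is adherent to `U ∖ T`. -/
theorem subset_closure_diff_of_isTotallyDisconnected {U T : Set ℂ} (hU : IsOpen U)
    (hTd : IsTotallyDisconnected (T ∩ U)) : U ⊆ closure (U \ T) := by
  intro p hp
  rw [Metric.mem_closure_iff]
  intro ε hε
  by_contra hno
  push Not at hno
  -- a small disc around `p` inside `U`
  obtain ⟨η, hη, hηU⟩ := Metric.isOpen_iff.1 hU p hp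
  set δ : ℝ := min ε η with hδ
  have hδpos : 0 < δ := lt_min hε hη
  have hballU : ball p δ ⊆ U := (ball_subset_ball (min_le_right _ _)).trans hηU
  -- the disc misses `U ∖ T`, hence lies in `T ∩ U`
  have hballT : ball p δ ⊆ T ∩ U := by
    intro z hz
    refine ⟨?_, hballU hz⟩
    by_contra hzT
    have h1 := hno z ⟨hballU hz, hzT⟩
    have h2 : dist p z < δ := by rw [dist_comm]; exact mem_ball.1 hz
    linarith [min_le_left ε η]
  -- a disc is preconnected and has two points
  have hsub : (ball p δ).Subsingleton := hTd _ hballT (convex_ball p δ).isPreconnected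
  have hq : p + (δ / 2 : ℝ) ∈ ball p δ := by
    rw [mem_ball, dist_eq_norm, add_sub_cancel_left, Complex.norm_real, Real.norm_eq_abs,
      abs_of_pos (by linarith)]
    linarith
  have h0 : ((δ / 2 : ℝ) : ℂ) = 0 := by
    have := congrArg (· - p) (hsub hq (mem_ball_self hδpos))
    simpa using this
  have : (δ / 2 : ℝ) = 0 := by exact_mod_cast h0
  linarith

/-- In a totally disconnected set every point is a point-component. -/
theorem connectedComponentIn_subset_singleton {α : Type*} [TopologicalSpace α] {S : Set α}
    (hS : IsTotallyDisconnected S) (p : α) : connectedComponentIn S p ⊆ {p} := by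
  by_cases hp : p ∈ S
  · exact ((hS _ (connectedComponentIn_subset _ _) isPreconnected_connectedComponentIn).eq_singleton_of_mem
      (mem_connectedComponentIn hp)).subset
  · rw [connectedComponentIn_eq_empty hp]
    exact empty_subset _

/-- A totally disconnected trace on the unit disc has empty interior. -/
theorem interior_inter_ball_eq_empty_of_isTotallyDisconnected {T : Set ℂ}
    (hTd : IsTotallyDisconnected (T ∩ ball (0 : ℂ) 1)) : interior (T ∩ ball (0 : ℂ) 1) = ∅ := by
  rw [Set.eq_empty_iff_forall_notMem]
  intro p hp
  have hpU : p ∈ ball (0 : ℂ) 1 := (interior_subset hp).2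
  have hadh := subset_closure_diff_of_isTotallyDisconnected isOpen_ball hTd hpU
  rw [Metric.mem_closure_iff] at hadh
  obtain ⟨ε, hε, hεsub⟩ := Metric.isOpen_iff.1 isOpen_interior p hp
  obtain ⟨b, hb, hpb⟩ := hadh ε hε
  exact hb.2 (interior_subset (hεsub (mem_ball'.2 hpb))).1

/-! ## 3. The survivor chain conjunct-wise: what implies `TD(h)` -/

/-- **`TW(h) ⟹ TD(h)`** (X-10 ⊆ X-11 conjunct-wise): a wall of zero length is totally disconnected. -/
theorem isTotallyDisconnected_wall_of_thinWall {h : ℝ} (htw : ThinWall h) :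
    IsTotallyDisconnected (closure (aliasedPoleSet h) ∩ ball (0 : ℂ) 1) :=
  isTotallyDisconnected_of_hausdorffMeasure_zero htw

/-- **`CC(h) ⟹ TD(h)`** (X-9 ⊆ X-11 conjunct-wise). -/
theorem isTotallyDisconnected_wall_of_countableClosure {h : ℝ} (hcc : CountableClosure h) :
    IsTotallyDisconnected (closure (aliasedPoleSet h) ∩ ball (0 : ℂ) 1) :=
  isTotallyDisconnected_wall_of_thinWall (thinWall_of_countableClosure hcc)

/-- **`dimH (T_h ∩ 𝔻) < 1 ⟹ TD(h)`**. -/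
theorem isTotallyDisconnected_wall_of_dimH_lt_one {h : ℝ}
    (hdim : dimH (closure (aliasedPoleSet h) ∩ ball (0 : ℂ) 1) < 1) :
    IsTotallyDisconnected (closure (aliasedPoleSet h) ∩ ball (0 : ℂ) 1) :=
  isTotallyDisconnected_wall_of_thinWall (thinWall_of_dimH_lt_one hdim)

/-- **RH ⟹ TD(h)** (vacuously: under RH the aliased pole field is empty). -/
theorem isTotallyDisconnected_wall_of_rh (hRH : RiemannHypothesis) (h : ℝ) :
    IsTotallyDisconnected (closure (aliasedPoleSet h) ∩ ball (0 : ℂ) 1) := by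
  rw [aliasedPoleSet_eq_empty_of_rh hRH h, closure_empty, empty_inter]
  exact isTotallyDisconnected_empty

/-- **ES ⟹ TD(h)** (`h > 0`; the eventual strip leaves a countable wall). -/
theorem isTotallyDisconnected_wall_of_eventualStrip {h : ℝ} (hh : 0 < h)
    (hES : ∀ η : ℝ, 0 < η →
      {ρ : ℂ | ρ ∈ ZetaZeros.riemannZetaNontrivialZeros ∧ η ≤ |ρ.re - 1 / 2|}.Finite) :
    IsTotallyDisconnected (closure (aliasedPoleSet h) ∩ ball (0 : ℂ) 1) :=
  isTotallyDisconnected_wall_of_thinWall (thinWall_of_eventualStrip hh hES)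

/-- **Finitely many off-line zeros ⟹ TD(h)**: so TD(h) does not imply RH by itself (T1 separating
scenario), and the residual CEIL(h) of X-11 is load-bearing. -/
theorem isTotallyDisconnected_wall_of_foz (hfoz : Theses.RuelleBand.CofiniteCriticalLine) (h : ℝ) :
    IsTotallyDisconnected (closure (aliasedPoleSet h) ∩ ball (0 : ℂ) 1) :=
  isTotallyDisconnected_wall_of_thinWall (thinWall_of_foz hfoz h)

/-- **X-10 ⟹ X-11 hypotheses-wise** (`h` arbitrary): `CEIL(h) ∧ TW(h)` implies `CEIL(h) ∧ TD(h)`. -/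
theorem latticeCeiling_and_isTotallyDisconnected_of_thinWall {h : ℝ}
    (h10 : LatticeCeiling h ∧ ThinWall h) :
    LatticeCeiling h ∧ IsTotallyDisconnected (closure (aliasedPoleSet h) ∩ ball (0 : ℂ) 1) :=
  ⟨h10.1, isTotallyDisconnected_wall_of_thinWall h10.2⟩

/-! ## 4. Under `CEIL(h)` a dust wall has no isolated pole (RH-free, kernel-free) -/

/-- **A dust wall does not separate the disc**: `TD(h)` makes `𝔻 ∖ T_h` preconnected
(item 21692's kernel `isPreconnected_ball_diff_of_isTotallyDisconnected` at `T = T_h`). -/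
theorem isPreconnected_ball_diff_wall_of_isTotallyDisconnected {h : ℝ}
    (htd : IsTotallyDisconnected (closure (aliasedPoleSet h) ∩ ball (0 : ℂ) 1)) :
    IsPreconnected (ball (0 : ℂ) 1 \ closure (aliasedPoleSet h)) :=
  isPreconnected_ball_diff_of_isTotallyDisconnected isClosed_closure htd

/-- **Every aliased pole is adherent to the regular set** when the wall is a dust wall. -/
theorem mem_closure_ball_diff_wall_of_isTotallyDisconnected {h : ℝ}
    (htd : IsTotallyDisconnected (closure (aliasedPoleSet h) ∩ ball (0 : ℂ) 1))
    {p : ℂ} (hp : p ∈ aliasedPoleSet h) :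
    p ∈ closure (ball (0 : ℂ) 1 \ closure (aliasedPoleSet h)) :=
  subset_closure_diff_of_isTotallyDisconnected isOpen_ball htd (mem_ball_zero_iff.2 hp.1)

/-- **Under `CEIL(h)` a dust wall has no isolated pole** (`h > 0`, RH-free, no kernel theorem needed):
if `T_h ∩ 𝔻` is totally disconnected then every aliased pole `p` with `‖p‖ + 2ε < 1` has a point
`q ≠ p` of `T_h` within `2ε` — the §19 WALLS theorem (`exists_near_of_preconnected_of_latticeCeiling`)
applies because a dust wall neither separates the disc nor contains a disc. -/
theorem exists_near_of_latticeCeiling_of_isTotallyDisconnected {h : ℝ} (hh : 0 < h)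
    (hceil : LatticeCeiling h)
    (htd : IsTotallyDisconnected (closure (aliasedPoleSet h) ∩ ball (0 : ℂ) 1))
    {p : ℂ} (hp : p ∈ aliasedPoleSet h) {ε : ℝ} (hε : 0 < ε) (hpε : ‖p‖ + 2 * ε < 1) :
    ∃ q ∈ closure (aliasedPoleSet h), ‖q - p‖ < 2 * ε ∧ q ≠ p :=
  exists_near_of_preconnected_of_latticeCeiling hh hceil
    (isPreconnected_ball_diff_wall_of_isTotallyDisconnected htd) hp
    (mem_closure_ball_diff_wall_of_isTotallyDisconnected htd hp) hε hpε

end Summit.RiemannHypothesis.RiemannHypothesis.Theorems.Splittings.ScrewDust
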